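import Literature.AnabelianGeometry.SemiGraphs.ArithmeticCurves
import Literature.AnabelianGeometry.SemiGraphs.TemperedSpecialFibre
import Literature.AnabelianGeometry.SemiGraphs.TemperedAbsoluteness
import Literature.AnabelianGeometry.SemiGraphs.TemperedTorsionPoints
import Literature.AnabelianGeometry.SemiGraphs.SpecialFibreDataNonVacuity
import Literature.AnabelianGeometry.SemiGraphs.TemperedCurveGroupLevelDataNonVacuity2
import Literature.AnabelianGeometry.SemiGraphs.OncePuncturedTemperedGroupPadicWitness
import HarnessLib

/-!
# [SemiAnbd] §3/§5/§6 ORIGIN certificates `SpecialFibreOrigin`, `ProSigmaOrigin`, `StableReductionOrigin`,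
# `AbsolutenessOrigin`, `TemperedTorsionOrigin`: inhabited at the cell's genuine models (non-vacuity)

Mochizuki, *Semi-graphs of anabelioids*, Publ. RIMS **42** (2006) [SemiAnbd]: Example 3.10 pp. 43–45,
Remark 3.10.1 p. 45 (pro-`Σ` tempered fundamental group), Example 5.6 p. 67 (the stable-reduction tower),
§6 pp. 75–78 (Thm. 6.8 (iii), Cor. 6.10 – Thm. 6.12) [cite: MochizukiSemiAnbd2006, Ex 3.10 pp.43-45]
[cite: MochizukiSemiAnbd2006, Rmk 3.10.1 p.45] [cite: MochizukiSemiAnbd2006, Ex 5.6, p. 67]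
[cite: MochizukiSemiAnbd2006, §6 pp.75-78].

PROOF-ONLY file (abc-iut cell, layer L3, NV lane; seat abc-iut-w6-d055, row «NV-L3 StableReductionOrigin /
SpecialFibreOrigin / StableReductionTower producers», abc-iut-L3-lead (gen 5) α51 (3)(a); theorems only — no
`def`, no `instance`, no new named fact).  Sequel of `TemperedOriginGenuineNonVacuity.lean` (p431594: the
principal certificates for `TemperedOrigin` / `TemperedMorphismOrigin` / `TemperedPiOrigin`).  The remaining
ORIGIN certificates of the layer — all with zero `Nonempty`/`∃` producers in abc-iut-w4-d098's
INHABITATION-CENSUS-L3 v2 (b6b2ecaaf2382289) — are inhabited here by PRINCIPAL certificates at GENUINE kernel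
data, every axiom field discharged (by `rfl`/projection) and every certificate that cannot honestly be issued at
the model left EMPTY and said so:

* `SpecialFibreOrigin ℚ_[p]`, `ProSigmaOrigin ℚ_[p]`, `StableReductionOrigin 𝓥 ℚ_[p]` (for EVERY vocabulary
  `𝓥`) at abc-iut-w5-d218's once-punctured `p`-adic model `OncePuncturedTemperedGroup.nonempty_model_padic`
  (`Π = (F̂₂ ×_Ẑ ℤ) × G_{ℚ_p}`, genuine `G_{ℚ_p}`): Tate certificate `(· = D)`, geometric certificate
  `(· = D.toTemperedArithmeticGroup)`; the pro-`Σ` certificate is issued — CORRECTLY for a curve — to the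
  trivial-kernel quotient datum at `Σ = Set.univ` ("as long as `Σ` contains …": for `Σ ⊇` all primes,
  `B^temp(X)^Σ = B^temp(X)`, so `Ker(Π ↠ Π^Σ) = 1` and `Ker(Δ ↠ Δ^Σ) = 1`); the special-fibre and the
  stable-reduction-TOWER certificates are EMPTY there: every `SpecialFibreData` producer of the tree lives
  over an algebraically closed base (`G_K = 1`), and `StableReductionTower 𝓥 D` has NO producer at a
  genuine-arithmetic `D` — its levels are `ArithSemiGraph`s whose arithmetic groups must be the (open) images
  of the `M_i` in `G_{ℚ_p}` and satisfy Def. 5.1 (i)(a) "topologically finitely generated" = the unfiled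
  classical input «`G_K` t.f.g.» (HOME/plan GAP-LEDGER G-L4t4-2) — FINDING recorded, not worked around;
* `SpecialFibreOrigin (AlgebraicClosure ℚ)` with a NON-EMPTY special-fibre certificate at the tree's
  special-fibre self-model `SpecialFibreData.exists_model` (abc-iut-L3 lineage: a genuine semi-graph of
  anabelioids with the hypotheses of Thm. 3.7 and a tempered chart, `Δ = Π = π₁^temp(𝒢^c)`, `G_K = 1`) — so
  the axiom `isOfGeometricOrigin_of_isSpecialFibreOf` is discharged NON-vacuously somewhere in the tree;
* `AbsolutenessOrigin p`, `TemperedTorsionOrigin p` at abc-iut-w5-d040's §6 datum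
  `exists_temperedCurve_groupLevelData_genuine` (`K = ℚ_p`, `Π^temp = G_{ℚ_p} × F̂₂`, a cusp, `Δ` nonabelian
  slim): the principal curve certificate with EMPTY morphism / `DLoc` / flag / structure / Kummer /
  cyclotome / torsion certificates (the model is not a curve: none of these data is certifiable there).

HONEST FRAMING.  Principal certificates at kernel MODELS are consistency / non-vacuity evidence for the typed
interfaces; they are NOT the intended certificates (André's `π₁^temp` of a curve, its stable model, its special
fibre), which no seat has constructed.  Nothing of [SemiAnbd] is asserted or denied for curves; typed ≠
proved; no side is taken on [IUTchIII] Cor. 3.12.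
-/

noncomputable section

namespace Literature.AnabelianGeometry.SemiGraphs

open _root_.CategoryTheory
open Literature.AlgebraicGeometry.Frobenioids (IsSlimGroup)

universe u v w

/-! ### The once-punctured `p`-adic model: `SpecialFibreOrigin`, `ProSigmaOrigin`, `StableReductionOrigin` -/

/-- At any `D : TemperedArithmeticGroup K` the pro-`Σ` quotient datum with BOTH kernels trivial exists (for a
curve and `Σ ⊇` all primes this IS the datum of Rmk. 3.10.1: `B^temp(X)^Σ = B^temp(X)`).
[cite: MochizukiSemiAnbd2006, Rmk 3.10.1 p.45] -/
theorem ProSigmaQuotient.exists_ker_eq_bot {K : Type u} [Field K] (D : TemperedArithmeticGroup K)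
    (Sig : Set ℕ) : ∃ Q : ProSigmaQuotient D Sig, Q.ker = ⊥ ∧ Q.kerDelta = ⊥ := by
  haveI : T2Space D.Pi := D.isTempered.t2Space
  exact ⟨{ ker := ⊥
           isClosed := by rw [Subgroup.coe_bot]; exact isClosed_singleton
           kerDelta := ⊥
           isClosed_kerDelta := by rw [Subgroup.coe_bot]; exact isClosed_singleton
           kerDelta_le := bot_le }, rfl, rfl⟩

/-- **`SpecialFibreOrigin ℚ_[p]` inhabited at the GENUINE `p`-adic model** (abc-iut-w5-d218,
`OncePuncturedTemperedGroup.nonempty_model_padic`): principal Tate certificate `(· = D)`, principal geometric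
certificate `(· = D.toTemperedArithmeticGroup)`, EMPTY special-fibre certificate (HONEST: the tree's
`SpecialFibreData` producers all live over algebraically closed bases; no special fibre is certifiable at
this `D`).  Both axioms hold (`rfl` / vacuously). [cite: MochizukiSemiAnbd2006, Ex 3.10 p.44] -/
theorem SpecialFibreOrigin.exists_principal_padic (p : ℕ) [Fact p.Prime] :
    ∃ (D : OncePuncturedTemperedGroup ℚ_[p]) (Ω : SpecialFibreOrigin ℚ_[p]),
      (∀ D', Ω.IsTateOrigin D' ↔ D' = D) ∧
      (∀ A, Ω.IsOfGeometricOrigin A ↔ A = D.toTemperedArithmeticGroup) ∧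
      (∀ A (S : SpecialFibreData A), ¬ Ω.IsSpecialFibreOf A S) ∧
      Ω.IsTateOrigin D ∧ Ω.IsOfGeometricOrigin D.toTemperedArithmeticGroup := by
  obtain ⟨D⟩ := OncePuncturedTemperedGroup.nonempty_model_padic p
  refine ⟨D, ⟨⟨fun A => A = D.toTemperedArithmeticGroup, fun D' => D' = D, ?_⟩, fun _ _ => False,
      fun _ _ h => h.elim⟩, fun _ => Iff.rfl, fun _ => Iff.rfl, fun _ _ h => h, rfl, rfl⟩
  rintro D' rfl
  rfl

/-- **`ProSigmaOrigin ℚ_[p]` inhabited at the GENUINE `p`-adic model**: the certificate of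
`SpecialFibreOrigin.exists_principal_padic` extended by the pro-`Σ` certificate issued exactly to the
trivial-kernel quotient datum of `D.toTemperedArithmeticGroup` at `Σ = Set.univ` — which, for a curve, IS the
pro-`Σ` datum of Rmk. 3.10.1 when `Σ` contains every prime (`Π^Σ = Π`, `Δ^Σ = Δ`); the certified datum EXISTS
(`ProSigmaQuotient.exists_ker_eq_bot`).  Axioms by `rfl` / projection. [cite: MochizukiSemiAnbd2006, Rmk 3.10.1 p.45] -/
theorem ProSigmaOrigin.exists_principal_padic (p : ℕ) [Fact p.Prime] :
    ∃ (D : OncePuncturedTemperedGroup ℚ_[p]) (Ω : ProSigmaOrigin ℚ_[p]),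
      (∀ D', Ω.IsTateOrigin D' ↔ D' = D) ∧
      (∀ A, Ω.IsOfGeometricOrigin A ↔ A = D.toTemperedArithmeticGroup) ∧
      (∀ A (S : SpecialFibreData A), ¬ Ω.IsSpecialFibreOf A S) ∧
      (∀ A (Sig : Set ℕ) (Q : ProSigmaQuotient A Sig), Ω.IsProSigmaOf A Sig Q ↔
        A = D.toTemperedArithmeticGroup ∧ Sig = Set.univ ∧ Q.ker = ⊥ ∧ Q.kerDelta = ⊥) ∧
      (∃ Q : ProSigmaQuotient D.toTemperedArithmeticGroup Set.univ, Ω.IsProSigmaOf _ Set.univ Q) ∧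
      Ω.IsTateOrigin D := by
  obtain ⟨D⟩ := OncePuncturedTemperedGroup.nonempty_model_padic p
  obtain ⟨Q, hQ, hQΔ⟩ := ProSigmaQuotient.exists_ker_eq_bot D.toTemperedArithmeticGroup Set.univ
  refine ⟨D, ⟨⟨⟨fun A => A = D.toTemperedArithmeticGroup, fun D' => D' = D, ?_⟩, fun _ _ => False,
      fun _ _ h => h.elim⟩,
      fun A Sig Q => A = D.toTemperedArithmeticGroup ∧ Sig = Set.univ ∧ Q.ker = ⊥ ∧ Q.kerDelta = ⊥,
      fun A Sig Q h => h.1⟩,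
    fun _ => Iff.rfl, fun _ => Iff.rfl, fun _ _ h => h, fun _ _ _ => Iff.rfl, ⟨Q, rfl, rfl, hQ, hQΔ⟩, rfl⟩
  rintro D' rfl
  rfl

/-- **`StableReductionOrigin 𝓥 ℚ_[p]` inhabited at the GENUINE `p`-adic model, for every vocabulary `𝓥`**:
principal Tate / geometric certificates and an EMPTY stable-reduction-tower certificate.  FINDING (recorded,
not worked around): `StableReductionTower 𝓥 D` has no producer at a genuine-arithmetic `D` — its levels
`𝔊_i`, `𝔊^c_i` are `ArithSemiGraph 𝓥`'s whose arithmetic profinite groups must map isomorphically onto the open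
images of the `M_i` in `G_{ℚ_p}` (`range_arithEmb`) and satisfy Def. 5.1 (i)(a) "`π̂₁(A)` topologically finitely
generated", i.e. the classical input «`G_K` is topologically finitely generated» that the cell carries as an
explicit binder (GAP-LEDGER G-L4t4-2); so the tower certificate cannot honestly be issued anywhere in the
tree today.  The structure's axiom holds vacuously. [cite: MochizukiSemiAnbd2006, Ex 5.6, p. 67] -/
theorem StableReductionOrigin.exists_principal_padic {Obj : Type u} [Category.{v} Obj]
    (𝓥 : SemiAnbdVocab.{u, v, w} Obj) (p : ℕ) [Fact p.Prime] :
    ∃ (D : OncePuncturedTemperedGroup ℚ_[p]) (Ω : StableReductionOrigin 𝓥 ℚ_[p]),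
      (∀ D', Ω.IsTateOrigin D' ↔ D' = D) ∧
      (∀ A, Ω.IsOfGeometricOrigin A ↔ A = D.toTemperedArithmeticGroup) ∧
      (∀ A (T : StableReductionTower 𝓥 A), ¬ Ω.IsStableReductionTowerOf A T) ∧
      Ω.IsTateOrigin D ∧ Ω.IsOfGeometricOrigin D.toTemperedArithmeticGroup := by
  obtain ⟨D⟩ := OncePuncturedTemperedGroup.nonempty_model_padic p
  refine ⟨D, ⟨⟨fun A => A = D.toTemperedArithmeticGroup, fun D' => D' = D, ?_⟩, fun _ _ => False,
      fun _ _ h => h.elim⟩, fun _ => Iff.rfl, fun _ => Iff.rfl, fun _ _ h => h, rfl, rfl⟩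
  rintro D' rfl
  rfl

/-! ### A NON-EMPTY special-fibre certificate: the special-fibre self-model over an algebraically closed base -/

/-- **`SpecialFibreOrigin` with a NON-EMPTY special-fibre certificate**: at the tree's special-fibre model
`SpecialFibreData.exists_model` (a genuine semi-graph of anabelioids `𝒢^c` with the hypotheses of Thm. 3.7 and a
tempered chart, `Π = Δ = π₁^temp(𝒢^c)` with the identity as admissible quotient, base `AlgebraicClosure ℚ`, so
`G_K = 1` — DEGENERATE ARITHMETIC, genuine geometry) the principal certificate issues `IsSpecialFibreOf` exactly
to that pair `(D, S)` and `IsOfGeometricOrigin` exactly to `D`; no Tate certificate.  The axiom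
`isOfGeometricOrigin_of_isSpecialFibreOf` is discharged by a projection, NON-vacuously.
[cite: MochizukiSemiAnbd2006, Ex 3.10 p.44] -/
theorem SpecialFibreOrigin.exists_certifying_specialFibre :
    ∃ (D : TemperedArithmeticGroup (AlgebraicClosure ℚ)) (S : SpecialFibreData D)
      (Ω : SpecialFibreOrigin (AlgebraicClosure ℚ)),
      Ω.IsSpecialFibreOf D S ∧ Ω.IsOfGeometricOrigin D ∧
      (∀ D' (S' : SpecialFibreData D'), Ω.IsSpecialFibreOf D' S' ↔
        (⟨D', S'⟩ : Σ A : TemperedArithmeticGroup (AlgebraicClosure ℚ), SpecialFibreData A) = ⟨D, S⟩) ∧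
      (∀ A, Ω.IsOfGeometricOrigin A ↔ A = D) ∧ (∀ D', ¬ Ω.IsTateOrigin D') := by
  obtain ⟨D, ⟨S⟩⟩ := SpecialFibreData.exists_model
  refine ⟨D, S, ⟨⟨fun A => A = D, fun _ => False, fun _ h => h.elim⟩,
      fun D' S' => (⟨D', S'⟩ : Σ A : TemperedArithmeticGroup (AlgebraicClosure ℚ), SpecialFibreData A) = ⟨D, S⟩,
      ?_⟩, rfl, rfl, fun _ _ => Iff.rfl, fun _ => Iff.rfl, fun _ h => h⟩
  intro D' S' h
  exact congrArg Sigma.fst h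

/-! ### The §6 genuine model of abc-iut-w5-d040: `AbsolutenessOrigin`, `TemperedTorsionOrigin` -/

/-- **`AbsolutenessOrigin p` inhabited at the GENUINE §6 model** (abc-iut-w5-d040,
`exists_temperedCurve_groupLevelData_genuine`: `K = ℚ_p`, `aug` onto `G_{ℚ_p}`, `GroupLevelData`, a cusp,
`Δ^temp` nonabelian slim, `Π^temp` compact): the principal curve certificate `(· = X)` with EMPTY certificates
for dominant morphisms, `DLoc_K`, arithmetic flags, canonical integral/discrete structures, Kummer data /
transport and cyclotome data — HONEST: `Π^temp = G_{ℚ_p} × F̂₂` with one formal cusp is not a curve, so none of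
these [Mzk8]-§4 data is certifiable there (the Cor. 6.10 / 6.11 / Thm. 6.12 `…Holds` statements are then
vacuous at this certificate and are NOT offered as evidence). [cite: MochizukiSemiAnbd2006, §6 pp.77-78] -/
theorem AbsolutenessOrigin.exists_principal_genuine (p : ℕ) [Fact p.Prime] :
    ∃ (X : TemperedCurve p) (Ω : AbsolutenessOrigin p),
      (∀ Y, Ω.IsHyperbolicCurveOrigin Y ↔ Y = X) ∧
      X.K = ⊥ ∧ Function.Surjective X.aug ∧ Nonempty X.GroupLevelData ∧ (∃ x : X.Pt, X.IsCusp x) ∧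
      (∃ g ∈ X.DeltaTemp, ∃ h ∈ X.DeltaTemp, g * h ≠ h * g) ∧
      IsSlimGroup X.PiTemp ∧ IsSlimGroup X.DeltaTemp ∧ CompactSpace X.PiTemp := by
  obtain ⟨X, hK, haug, hGLD, hcusp, hnab, hslimPi, hslimD, hcpt, -⟩ :=
    exists_temperedCurve_groupLevelData_genuine p
  exact ⟨X, ⟨⟨⟨fun Y => Y = X⟩, fun _ => False, fun _ => False, fun _ => False⟩,
      fun _ => False, fun _ => False, fun _ => False, fun _ => False⟩,
    fun _ => Iff.rfl, hK, haug, hGLD, hcusp, hnab, hslimPi, hslimD, hcpt⟩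

/-- **`TemperedTorsionOrigin p` inhabited at the GENUINE §6 model**: the principal curve certificate with EMPTY
morphism / `DLoc` / flag / torsion-point certificates (the model is not a once-punctured elliptic curve: no
torsion parametrisation `T(E) ⊗ ℚ/ℤ` is certifiable; Thm. 6.8 (iii) `TorsionPointsHolds` is vacuous there and not
offered as evidence). [cite: MochizukiSemiAnbd2006, Thm 6.8(iii) p.75] -/
theorem TemperedTorsionOrigin.exists_principal_genuine (p : ℕ) [Fact p.Prime] :
    ∃ (X : TemperedCurve p) (Ω : TemperedTorsionOrigin p),
      (∀ Y, Ω.IsHyperbolicCurveOrigin Y ↔ Y = X) ∧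
      X.K = ⊥ ∧ Function.Surjective X.aug ∧ Nonempty X.GroupLevelData ∧ (∃ x : X.Pt, X.IsCusp x) ∧
      (∃ g ∈ X.DeltaTemp, ∃ h ∈ X.DeltaTemp, g * h ≠ h * g) ∧
      IsSlimGroup X.PiTemp ∧ IsSlimGroup X.DeltaTemp ∧ CompactSpace X.PiTemp ∧
      Ω.TorsionPointsHolds := by
  obtain ⟨X, hK, haug, hGLD, hcusp, hnab, hslimPi, hslimD, hcpt, -⟩ :=
    exists_temperedCurve_groupLevelData_genuine p
  refine ⟨X, ⟨⟨⟨fun Y => Y = X⟩, fun _ => False, fun _ => False, fun _ => False⟩, fun _ => False⟩,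
    fun _ => Iff.rfl, hK, haug, hGLD, hcusp, hnab, hslimPi, hslimD, hcpt, ?_⟩
  intro Y Z aY aZ TY TZ _ _ haY _ _ _
  exact haY.elim

end Literature.AnabelianGeometry.SemiGraphs

end
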